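import Mathlib.Analysis.SpecialFunctions.Log.Basic
import Mathlib.NumberTheory.Harmonic.EulerMascheroni
import Mathlib.Algebra.Order.Chebyshev
import Literature.Barriers.QuantumAdvantage.LinearXEBSpoofing
import HarnessLib

/-!
# Sample estimators of the linear and logarithmic cross-entropy benchmarks

Topic `Literature/Computability/QuantumComplexity` (pub-qadeq lane, CLAIMS rows E-01…E-10 and E-46:
the two fidelity proxies that sampling-advantage experiments and their classical adjudications
report — Google/USTC linear XEB; Manabe–Gu–Pan's log-XEB `0.350 [0.298, 0.403]` on IBM's 2,051
doped-Clifford-sampling bitstrings).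

HONEST FRAMING: instance-level adjudication of specific advantage claims; no claim about BQP vs BPP
or the summit. This file only types the two ESTIMATORS as functions of the ideal probabilities of
the observed samples and proves the distribution-free comparison between them; the Porter–Thomas /
scrambled-noise reading of either number as a fidelity is an assumption of the primaries and is not
asserted here.

## Contents (all proved, 0 named facts)

* `linXEBHat N qs` — the sample linear-XEB estimator `N · (1/M) Σᵢ q(xᵢ) − 1` of `M` samples with
  ideal probabilities `qs i = q(xᵢ)` on `N` outcomes [cite: BarakChouGao2021, §1]; its population
  version is the tree's `Literature.Barriers.QuantumAdvantage.linearXEB`.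
* `logXEBHat N qs` — the sample log-XEB estimator `γ + ln N + (1/M) Σᵢ ln q(xᵢ)` exactly as printed
  (`n ln 2 = ln N` for `N = 2ⁿ`) [cite: ManabeGuPan2026, §5.2 eq. (33)].
* `avg_le_avg_of_dominates` / `linXEB_mean_le_of_dominates` (top-`k` selection by the ideal
  probability cannot lower the sample mean, hence the linear XEB [cite: PanZhang2022, §III]) and
  `avg_le_weightedAvg` (fidelity-weighted selection: `Σq²/Σq ≥ Σq/|s|`, Cauchy–Schwarz).
* `log_mul_le_mul_sub_one` (`ln(N q) ≤ N q − 1`, folklore), `logXEBHat_sub_gamma_le_linXEBHat`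
  (on the same samples, `log-XEB − γ ≤ linear XEB`), the population form
  `sum_mul_log_le_linearXEB` (`Σₓ p(x) ln(N q(x)) ≤ F_q(p)` for every sampled distribution `p`),
  and `logXEB_uniform_le_gamma` (a uniform sampler's population log-XEB is at most `γ`).

## References

* [ManabeGuPan2026] H. Manabe, H. Gu, F. Pan, *Classical Simulation and Design Frontiers for IBM's
  Doped Clifford Sampling Experiment*, arXiv:2608.13110v1 (2026), §5.2 eqs. (32)–(35), Table 1
  (p. 14–15 of the PDF). Read via `lit read arxiv:2608.13110`.
* [PanZhang2022] F. Pan, P. Zhang, *Simulation of quantum circuits using the big-batch tensor network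
  method*, Phys. Rev. Lett. 128, 030501 (2022) = arXiv:2103.03074, §III: “by selecting bitstrings with
  top probabilities, we arrive at 10⁶ bitstrings with F_XEB = 0.739” (read via `lit read arxiv:2103.03074`,
  chunk 6 L36).
* [GaoEtAl2024] X. Gao et al., *Limitations of linear cross-entropy as a measure for quantum
  advantage*, PRX Quantum 5, 010334 (2024) = arXiv:2112.01657, §IV.B (top-k post-processing).
* [BarakChouGao2021] B. Barak, C.-N. Chou, X. Gao, *Spoofing linear cross-entropy benchmarking in
  shallow quantum circuits*, ITCS 2021 (arXiv:2005.02421), §1 (the estimator `2ⁿ E_{x∼p} q_C(x) − 1`).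
-/

noncomputable section

open Finset

namespace Literature.Computability.QuantumComplexity.XEB

/-- The sample **linear-XEB estimator** of `M` samples whose ideal probabilities are `qs i` on an
outcome space of size `N`: `N · (1/M) Σᵢ qs i − 1`. [cite: BarakChouGao2021, §1] -/
def linXEBHat (N : ℕ) {M : ℕ} (qs : Fin M → ℝ) : ℝ :=
  (N : ℝ) * ((∑ i, qs i) / M) - 1

/-- The sample **log-XEB estimator** `γ + ln N + (1/M) Σᵢ ln (qs i)` (Euler–Mascheroni `γ`), as
printed with `n ln 2 = ln N`. [cite: ManabeGuPan2026, §5.2 eq. (33)] -/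
def logXEBHat (N : ℕ) {M : ℕ} (qs : Fin M → ℝ) : ℝ :=
  Real.eulerMascheroniConstant + Real.log N + (∑ i, Real.log (qs i)) / M

/-- `ln (N q) ≤ N q − 1` for `N q > 0`, i.e. `ln N + ln q ≤ N q − 1`. [folklore] -/
theorem log_mul_le_mul_sub_one {N q : ℝ} (hN : 0 < N) (hq : 0 < q) :
    Real.log N + Real.log q ≤ N * q - 1 := by
  rw [← Real.log_mul hN.ne' hq.ne']
  exact Real.log_le_sub_one_of_pos (mul_pos hN hq)

/-- **On the same samples, log-XEB minus `γ` never exceeds linear XEB** (termwise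
`ln(N q(xᵢ)) ≤ N q(xᵢ) − 1`); distribution-free, for any positive ideal probabilities.
[folklore] -/
theorem logXEBHat_sub_gamma_le_linXEBHat {N M : ℕ} (hN : 0 < N) (hM : 0 < M) (qs : Fin M → ℝ)
    (hq : ∀ i, 0 < qs i) :
    logXEBHat N qs - Real.eulerMascheroniConstant ≤ linXEBHat N qs := by
  unfold logXEBHat linXEBHat
  have hMr : (0 : ℝ) < M := by exact_mod_cast hM
  have hNr : (0 : ℝ) < N := by exact_mod_cast hN
  have hsum : ∑ i, (Real.log (N : ℝ) + Real.log (qs i)) ≤ ∑ i, ((N : ℝ) * qs i - 1) :=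
    sum_le_sum fun i _ => log_mul_le_mul_sub_one hNr (hq i)
  rw [sum_add_distrib, sum_const, card_univ, Fintype.card_fin, nsmul_eq_mul,
    sum_sub_distrib, sum_const, card_univ, Fintype.card_fin, nsmul_eq_mul, mul_one,
    ← mul_sum] at hsum
  -- divide the summed inequality by `M`
  have hdiv : ((M : ℝ) * Real.log N + ∑ i, Real.log (qs i)) / M ≤
      ((N : ℝ) * ∑ i, qs i - M) / M :=
    div_le_div_of_nonneg_right hsum hMr.le
  have h1 : ((M : ℝ) * Real.log N + ∑ i, Real.log (qs i)) / M =
      Real.log N + (∑ i, Real.log (qs i)) / M := by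
    field_simp
  have h2 : ((N : ℝ) * ∑ i, qs i - M) / M = (N : ℝ) * ((∑ i, qs i) / M) - 1 := by
    field_simp
  rw [h1, h2] at hdiv
  linarith

/-- **Population form**: for every sampled distribution `p` (nonnegative) and positive ideal `q`
on `N = |α|` outcomes, `Σₓ p(x) ln(N q(x)) ≤ F_q(p)` with the tree's
`Literature.Barriers.QuantumAdvantage.linearXEB` (`F_q(p) = N Σₓ q(x) p(x) − 1`), provided
`Σ p = 1`. [folklore] -/
theorem sum_mul_log_le_linearXEB {α : Type*} [Fintype α] [Nonempty α] (q p : α → ℝ)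
    (hq : ∀ x, 0 < q x) (hp0 : ∀ x, 0 ≤ p x) (hp1 : ∑ x, p x = 1) :
    ∑ x, p x * Real.log ((Fintype.card α : ℝ) * q x) ≤
      Literature.Barriers.QuantumAdvantage.linearXEB q p := by
  unfold Literature.Barriers.QuantumAdvantage.linearXEB
  have hN : (0 : ℝ) < Fintype.card α := by exact_mod_cast Fintype.card_pos
  calc ∑ x, p x * Real.log ((Fintype.card α : ℝ) * q x)
      ≤ ∑ x, p x * ((Fintype.card α : ℝ) * q x - 1) :=
        sum_le_sum fun x _ => mul_le_mul_of_nonneg_left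
          (Real.log_le_sub_one_of_pos (mul_pos hN (hq x))) (hp0 x)
    _ = (Fintype.card α : ℝ) * ∑ x, q x * p x - ∑ x, p x := by
        rw [mul_sum, ← sum_sub_distrib]
        exact sum_congr rfl fun x _ => by ring
    _ = _ := by rw [hp1]

/-- **A uniform sampler's population log-XEB is at most `γ`**: `γ + Σₓ (1/N) ln(N q(x)) ≤ γ`
for every positive ideal distribution `q` (`Σ q = 1`), since the uniform distribution has linear
XEB `0` (`linearXEB_uniform`). [folklore] -/
theorem logXEB_uniform_le_gamma {α : Type*} [Fintype α] [Nonempty α] (q : α → ℝ)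
    (hq : ∀ x, 0 < q x) (hq1 : ∑ x, q x = 1) :
    Real.eulerMascheroniConstant +
        ∑ x, (Fintype.card α : ℝ)⁻¹ * Real.log ((Fintype.card α : ℝ) * q x) ≤
      Real.eulerMascheroniConstant := by
  have hN : (0 : ℝ) < Fintype.card α := by exact_mod_cast Fintype.card_pos
  have hu1 : ∑ _x : α, (Fintype.card α : ℝ)⁻¹ = 1 := by
    rw [sum_const, card_univ, nsmul_eq_mul, mul_inv_cancel₀ hN.ne']
  have h := sum_mul_log_le_linearXEB q (fun _ => (Fintype.card α : ℝ)⁻¹) hq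
    (fun _ => inv_nonneg.mpr hN.le) hu1
  rw [Literature.Barriers.QuantumAdvantage.linearXEB_uniform q hq1] at h
  linarith

/-! ### Post-selection on computed ideal probabilities cannot lower the benchmark

When a classical sampler COMPUTES the ideal probabilities of `M` candidate bitstrings and then
outputs a sub-selection, two selections are used in print: keeping the `k` candidates with the
largest ideal probability ("by selecting bitstrings with top probabilities, we arrive at `10⁶`
bitstrings with `F_XEB = 0.739`" out of `2²¹` computed ones [cite: PanZhang2022, §III (results,
post-selection paragraph)]; the top-`k` heuristic of [cite: GaoEtAl2024, §IV.B (top-k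
post-processing method)]) and drawing a candidate with probability proportional to its ideal
probability (fidelity-weighted sampling [cite: ManabeGuPan2026, §5.2]). Both raise the sample mean
of the ideal probabilities, hence the linear-XEB estimate `N · mean − 1`, relative to outputting a
uniformly random candidate; the two deterministic inequalities are recorded here. They are
statements about selection BY THE IDEAL `q` itself; selection by a merely correlated score (Gao et
al.'s `q_C`) is a heuristic and is not covered. -/

/-- **Top-`k` by the ideal probability raises the mean.** If `t ⊆ s` is nonempty and every
selected candidate has ideal probability at least that of every discarded one, then the mean over
`t` is at least the mean over `s`. [cite: PanZhang2022, §III (post-selection paragraph)]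
[cite: GaoEtAl2024, §IV.B] -/
theorem avg_le_avg_of_dominates {α : Type*} [DecidableEq α] {s t : Finset α} (q : α → ℝ)
    (hts : t ⊆ s)
    (ht : t.Nonempty) (hdom : ∀ x ∈ t, ∀ y ∈ s \ t, q y ≤ q x) :
    (∑ x ∈ s, q x) / s.card ≤ (∑ x ∈ t, q x) / t.card := by
  set a : ℝ := (∑ x ∈ t, q x) / t.card with ha
  have htc : (0 : ℝ) < t.card := by exact_mod_cast ht.card_pos
  have hsc : (0 : ℝ) < s.card := by exact_mod_cast (ht.mono hts).card_pos
  -- every discarded candidate is below the selected mean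
  have hy : ∀ y ∈ s \ t, q y ≤ a := by
    intro y hy
    rw [ha, le_div_iff₀ htc]
    calc q y * t.card = ∑ _x ∈ t, q y := by rw [sum_const, nsmul_eq_mul, mul_comm]
      _ ≤ ∑ x ∈ t, q x := sum_le_sum fun x hx => hdom x hx y hy
  have hsplit : ∑ x ∈ s, q x = ∑ x ∈ t, q x + ∑ x ∈ s \ t, q x := by
    rw [← sum_union disjoint_sdiff, union_sdiff_of_subset hts]
  have hrest : ∑ x ∈ s \ t, q x ≤ ((s \ t).card : ℝ) * a := by
    calc ∑ x ∈ s \ t, q x ≤ ∑ _x ∈ s \ t, a := sum_le_sum hy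
      _ = ((s \ t).card : ℝ) * a := by rw [sum_const, nsmul_eq_mul]
  have ht_eq : ∑ x ∈ t, q x = (t.card : ℝ) * a := by
    rw [ha, mul_div_cancel₀ _ htc.ne']
  have hcard : ((s \ t).card : ℝ) = s.card - t.card := by
    rw [card_sdiff_of_subset hts, Nat.cast_sub (card_le_card hts)]
  rw [hcard] at hrest
  rw [div_le_iff₀ hsc, hsplit, ht_eq]
  nlinarith [hrest]

/-- In linear-XEB form: `N · mean_s(q) − 1 ≤ N · mean_t(q) − 1` for a top-`k`-by-`q` selection
`t ⊆ s`. [cite: PanZhang2022, §III] -/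
theorem linXEB_mean_le_of_dominates {α : Type*} [DecidableEq α] {s t : Finset α} (N : ℕ)
    (q : α → ℝ)
    (hts : t ⊆ s) (ht : t.Nonempty) (hdom : ∀ x ∈ t, ∀ y ∈ s \ t, q y ≤ q x) :
    (N : ℝ) * ((∑ x ∈ s, q x) / s.card) - 1 ≤ (N : ℝ) * ((∑ x ∈ t, q x) / t.card) - 1 := by
  have h := avg_le_avg_of_dominates q hts ht hdom
  have hN : (0 : ℝ) ≤ N := Nat.cast_nonneg N
  nlinarith

/-- **Fidelity-weighted selection raises the mean.** Drawing a candidate `x ∈ s` with probability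
`q(x) / Σ_s q` gives expected ideal probability `Σ_s q² / Σ_s q`, which is at least the plain mean
`Σ_s q / |s|` (Cauchy–Schwarz). [cite: ManabeGuPan2026, §5.2 (fidelity-weighted sampling)] -/
theorem avg_le_weightedAvg {α : Type*} {s : Finset α} (q : α → ℝ) (hs : s.Nonempty)
    (hpos : 0 < ∑ x ∈ s, q x) :
    (∑ x ∈ s, q x) / s.card ≤ (∑ x ∈ s, q x ^ 2) / ∑ x ∈ s, q x := by
  have hsc : (0 : ℝ) < s.card := by exact_mod_cast hs.card_pos
  rw [div_le_div_iff₀ hsc hpos]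
  have hcs : (∑ x ∈ s, q x) ^ 2 ≤ s.card * ∑ x ∈ s, q x ^ 2 := sq_sum_le_card_mul_sum_sq
  nlinarith [hcs]

end Literature.Computability.QuantumComplexity.XEB

end
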